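import Literature.Computability.QuantumAlgorithms.ApexCliqueCount

/-!
# Apex cliques encode independent sets (DEQ-A07F): the signed clique count of
`K(3,k) − D_H` is `(-1)^k ·` (number of independent sets of `H`)

HONEST FRAMING: instance-level adjudication of specific advantage claims; no claim about
BQP vs BPP or the summit.

Context (cell pub-qadeq, claim A-07 = Berry et al., arXiv:2209.13581v3 = PRX Quantum 5, 010319
(2024), §4.1 family `K(m,k)`; refined open question OPEN-1, model (W) = adversarial edge deletions).
DEQ-A07F.md (unit pub-qadeq-deq-1) shows that inside the family `K(m,k) − D` the invariant
`β_{k-1}(Cl(K(m,k) − D))` — and the Euler-characteristic target `e(G) = Σ_j (-1)^{k-j} c_j(G)` of the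
estimator EULER-MC of DEQ-A07/A07E — specialise, for suitable `D = D_H`, to the number of independent
sets (more generally the hard-core partition function) of an arbitrary graph `H` on `k` vertices, so
that exact evaluation is #P-hard [Dyer–Greenhill 2000; Greenhill 2000] and relative approximation has
no FPRAS unless NP = RP [Sly 2010, Thm 2; Galanis–Štefankovič–Vigoda 2016, Thm 1] (cited there, not here).

This file proves, sorry-free, the purely combinatorial identity behind the `m = 3` case
(Theorem W1 of DEQ-A07F.md with `(a,b) = (1,1)`), as a corollary of
`Literature.Computability.QuantumAlgorithms.ApexCliqueCount.signed_clique_count` (DEQ-A07 Prop. C):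

* vertices `Fin k × Fin 3`: part `a` consists of the apex `(a,0)`, a *free copy* `(a,1)` and an
  *H-copy* `(a,2)`; `encAdj hadj` joins two vertices iff they lie in different parts and are not two
  H-copies `(a,2), (b,2)` over an edge `hadj a b = true` of `H`;
* `full_cliques_eq_image`: the cliques meeting every part in a non-apex vertex are exactly the images
  `encClique I` of the independent sets `I` of `H` (H-copies on `I`, free copies elsewhere);
* `signed_clique_count_indepSets`: `Σ_{S clique} (-1)^|S| = (-1)^k · #(independent sets of H)`.

No complexity-theoretic statement is formalised (Mathlib has no #P / FPRAS notions); the hardness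
conclusions live in DEQ-A07F.md with their citations.  Everything here is `[folklore]`-level finite
combinatorics; no named fact, no axiom.
-/

namespace Summit.QuantumAdvantage.Dequantization.ApexIndependentSets

open Finset Literature.Computability.QuantumAlgorithms.ApexCliqueCount

variable {k : ℕ}

/-- The independent-set encoding on `Fin k × Fin 3` (position `0` = apex, `1` = free copy,
`2` = H-copy): different parts are joined except two H-copies over an edge of `H`. -/
def encAdj (hadj : Fin k → Fin k → Bool) (u v : Vx k 2) : Bool :=
  if u.1 = v.1 then false else if u.2 = 2 ∧ v.2 = 2 then !(hadj u.1 v.1) else true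

/-- Independent sets of `H` (given as a Boolean adjacency; only off-diagonal entries are read). -/
def indepSets (hadj : Fin k → Fin k → Bool) : Finset (Finset (Fin k)) :=
  univ.filter (fun I => ∀ u ∈ I, ∀ v ∈ I, u ≠ v → hadj u v = false)

/-- The position chosen in part `a` by the clique attached to `I`: H-copy on `I`, free copy elsewhere. -/
def encPos (I : Finset (Fin k)) (a : Fin k) : Fin 3 := if a ∈ I then 2 else 1

/-- The transversal clique attached to a vertex subset `I` of `H`. -/
def encClique (I : Finset (Fin k)) : Finset (Vx k 2) := univ.image (fun a : Fin k => (a, encPos I a))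

/-- `[folklore]` unfolding of `encAdj`: adjacent iff different parts and not two H-copies over an edge. -/
lemma encAdj_true_iff (hadj : Fin k → Fin k → Bool) (u v : Vx k 2) :
    encAdj hadj u v = true ↔ u.1 ≠ v.1 ∧ (u.2 = 2 → v.2 = 2 → hadj u.1 v.1 = false) := by
  unfold encAdj
  split_ifs with h1 h2
  · simp [h1]
  · simp [h1, h2]
  · constructor
    · intro _; refine ⟨h1, fun hu hv => (h2 ⟨hu, hv⟩).elim⟩
    · intro _; rfl

/-- `[folklore]` the encoding adjacency is symmetric when `H` is. -/
lemma encAdj_symm (hadj : Fin k → Fin k → Bool) (hsymm : ∀ a b, hadj a b = hadj b a)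
    (u v : Vx k 2) : encAdj hadj u v = encAdj hadj v u := by
  rcases Bool.eq_false_or_eq_true (encAdj hadj u v) with h | h <;>
    rcases Bool.eq_false_or_eq_true (encAdj hadj v u) with h' | h'
  · rw [h, h']
  · exfalso
    rw [encAdj_true_iff] at h
    have : encAdj hadj v u = true := by
      rw [encAdj_true_iff]
      exact ⟨fun e => h.1 e.symm, fun hv hu => by rw [hsymm]; exact h.2 hu hv⟩
    rw [this] at h'; exact Bool.noConfusion h'
  · exfalso
    rw [encAdj_true_iff] at h'
    have : encAdj hadj u v = true := by
      rw [encAdj_true_iff]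
      exact ⟨fun e => h'.1 e.symm, fun hu hv => by rw [hsymm]; exact h'.2 hv hu⟩
    rw [this] at h; exact Bool.noConfusion h
  · rw [h, h']

/-- `[folklore]` no edges inside a part. -/
lemma encAdj_nopart (hadj : Fin k → Fin k → Bool) (a : Fin k) (i j : Fin 3) :
    encAdj hadj (a, i) (a, j) = false := by
  simp [encAdj]

/-- `[folklore]` every `(a,0)` is an apex (adjacent to all vertices of the other parts). -/
lemma encAdj_apex (hadj : Fin k → Fin k → Bool) (a b : Fin k) (j : Fin 3) (hab : a ≠ b) :
    encAdj hadj (a, 0) (b, j) = true := by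
  rw [encAdj_true_iff]
  refine ⟨hab, fun h _ => ?_⟩
  exact absurd h (by simp)

/-- `[folklore]` the encoded clique never uses an apex. -/
lemma encPos_ne_zero (I : Finset (Fin k)) (a : Fin k) : encPos I a ≠ 0 := by
  unfold encPos; split_ifs <;> decide

/-- `[folklore]` the encoded clique uses the H-copy of part `a` iff `a ∈ I`. -/
lemma encPos_eq_two_iff (I : Finset (Fin k)) (a : Fin k) : encPos I a = 2 ↔ a ∈ I := by
  unfold encPos; split_ifs with h <;> simp [h]

/-- `[folklore]` membership in the encoded clique. -/
lemma mem_encClique (I : Finset (Fin k)) (v : Vx k 2) : v ∈ encClique I ↔ v.2 = encPos I v.1 := by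
  unfold encClique
  constructor
  · intro hv
    obtain ⟨a, _, rfl⟩ := Finset.mem_image.mp hv
    rfl
  · intro hv
    refine Finset.mem_image.mpr ⟨v.1, Finset.mem_univ _, ?_⟩
    obtain ⟨a, i⟩ := v
    simp only at hv; rw [hv]

/-- `[folklore]` different vertex subsets give different cliques. -/
lemma encClique_injective : Function.Injective (encClique (k := k)) := by
  intro I J h
  ext a
  have h1 : ((a, encPos I a) : Vx k 2) ∈ encClique J := by rw [← h, mem_encClique]
  rw [mem_encClique] at h1
  simp only at h1
  rw [← encPos_eq_two_iff I a, ← encPos_eq_two_iff J a, h1]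

/-- `[folklore]` the clique attached to an independent set is a clique meeting every part off the apex. -/
lemma encClique_mem (hadj : Fin k → Fin k → Bool) {I : Finset (Fin k)} (hI : I ∈ indepSets hadj) :
    encClique I ∈ (cliques (encAdj hadj)).filter Full := by
  rw [indepSets, Finset.mem_filter] at hI
  rw [Finset.mem_filter]
  refine ⟨?_, ?_⟩
  · simp only [cliques, Finset.mem_filter, Finset.mem_univ, true_and]
    intro u hu v hv huv
    rw [mem_encClique] at hu hv
    rw [encAdj_true_iff]
    have hne : u.1 ≠ v.1 := by
      intro e; apply huv
      obtain ⟨a, i⟩ := u; obtain ⟨b, j⟩ := v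
      simp only at e hu hv; subst e; rw [hu, hv]
    refine ⟨hne, fun hu2 hv2 => ?_⟩
    rw [hu, encPos_eq_two_iff] at hu2
    rw [hv, encPos_eq_two_iff] at hv2
    exact hI.2 u.1 hu2 v.1 hv2 hne
  · intro a
    refine ⟨(a, encPos I a), (mem_encClique I _).mpr rfl, rfl, encPos_ne_zero I a⟩

/-- **Full cliques = encoded independent sets.** -/
theorem full_cliques_eq_image (hadj : Fin k → Fin k → Bool) :
    (cliques (encAdj hadj)).filter Full = (indepSets hadj).image encClique := by
  ext S
  constructor
  · intro hS
    rw [Finset.mem_filter] at hS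
    have hc : IsClique (encAdj hadj) S := by simpa [cliques] using hS.1
    have hF := hS.2
    -- the independent set read off from the H-copies in S
    set I : Finset (Fin k) := univ.filter (fun a => ((a, (2 : Fin 3)) : Vx k 2) ∈ S) with hIdef
    have hmemI : ∀ a, a ∈ I ↔ ((a, (2 : Fin 3)) : Vx k 2) ∈ S := by
      intro a; rw [hIdef, Finset.mem_filter]; simp
    have hna := (card_eq_of_full (encAdj_nopart hadj) hc hF).2
    -- S = encClique I
    have hSI : S = encClique I := by
      ext v
      rw [mem_encClique]
      constructor
      · intro hv
        have hv0 := hna v hv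
        by_cases h2 : v.2 = 2
        · have : v.1 ∈ I := by
            rw [hmemI]; obtain ⟨a, i⟩ := v; simp only at h2 ⊢; rw [← h2]; exact hv
          rw [h2, eq_comm, encPos_eq_two_iff]; exact this
        · have h1 : v.2 = 1 := by
            have : ∀ j : Fin 3, j ≠ 0 → j ≠ 2 → j = 1 := by decide
            exact this v.2 hv0 h2
          have : v.1 ∉ I := by
            rw [hmemI]; intro hv2
            have := eq_of_same_part (encAdj_nopart hadj) hc hv hv2 rfl
            rw [this] at h1; exact absurd h1 (by simp)
          rw [h1]; unfold encPos; rw [if_neg this]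
      · intro hv
        obtain ⟨w, hw, hw1, hw0⟩ := hF v.1
        by_cases hI : v.1 ∈ I
        · have hv2 : v.2 = 2 := by rw [hv, encPos_eq_two_iff]; exact hI
          have : ((v.1, (2 : Fin 3)) : Vx k 2) ∈ S := (hmemI _).mp hI
          obtain ⟨a, i⟩ := v; simp only at hv2 this ⊢; rw [hv2]; exact this
        · have hv1 : v.2 = 1 := by rw [hv]; unfold encPos; rw [if_neg hI]
          have hw2 : w.2 ≠ 2 := by
            intro hw2; apply hI; rw [hmemI]
            obtain ⟨b, j⟩ := w; simp only at hw1 hw2; subst hw1; rw [← hw2]; exact hw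
          have hwj : w.2 = 1 := by
            have : ∀ j : Fin 3, j ≠ 0 → j ≠ 2 → j = 1 := by decide
            exact this w.2 hw0 hw2
          have : w = v := by
            obtain ⟨a, i⟩ := v; obtain ⟨b, j⟩ := w
            simp only at hw1 hwj hv1 ⊢; rw [hw1, hwj, hv1]
          rw [← this]; exact hw
    -- I is independent
    have hI : I ∈ indepSets hadj := by
      rw [indepSets, Finset.mem_filter]
      refine ⟨Finset.mem_univ _, fun u hu v hv huv => ?_⟩
      have hu' := (hmemI u).mp hu
      have hv' := (hmemI v).mp hv
      have hadj' := hc _ hu' _ hv' (by intro e; apply huv; exact congrArg Prod.fst e)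
      rw [encAdj_true_iff] at hadj'
      exact hadj'.2 rfl rfl
    exact Finset.mem_image.mpr ⟨I, hI, hSI.symm⟩
  · intro hS
    obtain ⟨I, hI, rfl⟩ := Finset.mem_image.mp hS
    exact encClique_mem hadj hI

/-- **DEQ-A07F, Theorem W1 for `(m,a,b) = (3,1,1)` (combinatorial form).**  For every graph `H` on
`Fin k` (symmetric Boolean adjacency), the signed clique count of the encoding graph `K(3,k) − D_H`
equals `(-1)^k ·` (number of independent sets of `H`, the empty set included). -/
theorem signed_clique_count_indepSets (hadj : Fin k → Fin k → Bool)
    (hsymm : ∀ a b, hadj a b = hadj b a) :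
    (∑ S ∈ cliques (encAdj hadj), (-1 : ℤ) ^ S.card)
      = (-1 : ℤ) ^ k * ((indepSets hadj).card : ℤ) := by
  rw [signed_clique_count (encAdj_symm hadj hsymm) (encAdj_nopart hadj)
    (fun a b j hab => encAdj_apex hadj a b j hab), full_cliques_eq_image,
    Finset.card_image_of_injective _ encClique_injective]

/-- Sanity instance (kernel-evaluated): for the path `P₃` on `Fin 3` (edges `0–1`, `1–2`) there are
`5` independent sets (`∅, {0}, {1}, {2}, {0,2}`), so the signed clique count is `(-1)^3 · 5 = -5`. -/
example : (∑ S ∈ cliques (encAdj (k := 3) (fun a b => decide ((a.val + 1 = b.val) ∨ (b.val + 1 = a.val)))),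
    (-1 : ℤ) ^ S.card) = -5 := by
  rw [signed_clique_count_indepSets _ (by decide)]
  decide

end Summit.QuantumAdvantage.Dequantization.ApexIndependentSets
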